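import Summits.BirchSwinnertonDyer.BirchSwinnertonDyer.Theorems.PrintCf2RamifiedOffTYZGenusKernelForm
import Literature.NumberTheory.EllipticCurves.Smith2016.CongruentNumberGenusDeterminantRowFiveA
import Literature.NumberTheory.EllipticCurves.Smith2016.CongruentNumberSmithMatrixSelmer
import HarnessLib

/-!
# Route `PrintCf2`, crux stmt-BirchSwinnertonDyer-20509 `RamifiedOffTYZOfFacts` — THE FIRST GENUS SUM IS A LINEAR
# FUNCTIONAL OF MONSKY'S KERNEL VECTOR (`n ≡ 5 (mod 8)`, `s(n) = 1`): `Σ₁(n) ≡ Σ_{pᵢ≡5,7 (8)} xᵢ + Σ_{pᵢ≡3 (4)} yᵢ (mod 2)`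
# (cell `bsd-print-cf2`, seat p2 «2-descent matrix road», g4; file 3)

HONEST FRAMING (cell `bsd-print-cf2`, HOME `run/shared/lean/pub/bsd-print-cf2/`; crux 20509 OPEN): THEOREMS ONLY — no
definition, no named fact, nothing asserted, nothing booked, NO fact hypothesis. Companion of file 1
(`PrintCf2RamifiedOffTYZGenusKernelForm.lean`, p567656: `Σ₂′(2m) ≡ t·β` for even `n`) on the ODD side `n ≡ 5 (mod 8)`,
where A. Smith's Theorem 2.2 row 5a is a TREE THEOREM for every `k` (`Smith2016.genusSum₁_eq_border_adjugate_five`: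
`Σ₁(n) ≡ uᵀ adj(M₁) u (mod 2)`, `u = (t + z; 0)`, `M₁ = (A + Aᵀ, Aᵀ; A, D₂)`, `t = ((−1/pᵢ)₊)`, `z = ((2/pᵢ)₊)`).
The only new input is the KERNEL DICTIONARY between Monsky's odd matrix `M = (A + D₂, D₂; D₂, A + D₋₂)` (tree
`monskyMatrixOdd`, whose kernel vectors `(x; y)` carry the `ρ`-criterion of `RhoIndexMonskyKernelOdd/Sharp`) and Smith's
symmetric `M₁`, which is NOT a plain congruence: Monsky's intermediate `M₁ᴹ = M + c cᵀ` (`c = (0; t)`, tree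
`monskyMatrixOdd_add_vecMulVec`) differs from `M` by a rank-one term, and `M₁ = (I I; I 0) M₁ᴹ (I 0; I I)` (tree
`conj_M₁_eq`). For `n ≡ 1 (mod 4)` (`Σ tᵢ = 0`):

* §1 `smithOne_mulVec_dict_eq_zero` — a Monsky kernel vector `(x; y)` gives the Smith kernel vector
  **`v^S = (x + (t·y)𝟙 ; x + y)`** (the torsion-translate `(t·y)·𝟙` is the new point: `M 𝟙 = c`, `c·𝟙 = Σt = 0`);
  `smithOne_ker_pair` — with `s(n) = 1` (two-element Monsky kernel) this is THE nonzero Smith kernel vector;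
* §2 **`genusSum₁_eq_dotProduct_of_kerPair_five`** — for `n = p₁⋯p_k ≡ 5 (mod 8)` with Monsky kernel `{0, (x; y)}`:
  `Σ₁(n) ≡ (t+z)·x + t·y (mod 2)` (file 1's `bᵀ adj(M) b = b·v` for symmetric `M` with kernel `{0, v}`, and
  `(t+z)·𝟙 = 1` for `n ≡ 5 (8)`);
* §3 on the `ρ = 0` shapes of the flag-free TYZρ door (`x + y ∈ {0, 𝟙}`, tree `rhoIndex_eq_one_of_monskyKernel_odd`):
  **`Σ₁(n) ≡ z·x = Σ_{pᵢ ≡ ±3 (8)} xᵢ`** in BOTH shapes (`genusSum₁_eq_of_kerShape_zero_five`,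
  `genusSum₁_eq_of_kerShape_one_five`) — the TYZ-loudness of a `ρ = 0` member `n ≡ 5 (8)` is read off the support of the
  Selmer element, with no class-group computation.
Checked numerically before writing on all 3 608 square-free `n ≡ 5 (8)`, `n ≤ 4·10⁴`, with `s(n) = 1` (seat folder
`kit/scanT1`; the equivalent form `Σ₁ ≡ (t+z)·y` uses the kernel relations `t·x = 0`, `z·(x+y) = 0`). Unlike the even case
(file 2: the ρ-six class is EMPTY) no class is emptied here: for odd `n` the `ρ = 0` shapes do not fix the parity of `Σ₁`.
Beyond print: YES (identity not in print; Smith's row 5a is a preprint identity proved in the tree by `bsd-monsky`).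
PARTITION: 0 cells moved.

## References

* [Smith2016CongruentDensity] A. Smith, arXiv:1603.08479v2, §2 (M₁, y, z, A), Table 2 row 5a, Thm. 2.2, §2.2, Prop. 3.2.
* [HeathBrown1994SelmerCongruentII] D. R. Heath-Brown, Invent. Math. 118 (1994), Appendix (P. Monsky), typescript
  p. 39 L27–L41 (M, display (31)), p. 40 L1–L24 (M₁ = M + cd, M₂ = (I I; I 0) M₁ (I 0; I I)).
* [TianYuanZhang2017] Y. Tian, X. Yuan, S.-W. Zhang, Asian J. Math. 21 (2017), §1 (ρ(n)), Thm. 1.2 (Σ₁ for n ≡ 5 (8)).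
* [HornJohnson2013] R. A. Horn, C. R. Johnson, *Matrix Analysis*, 2nd ed., §0.8.2.
-/

noncomputable section

open scoped Classical

open Matrix Finset WeierstrassCurve
open Literature.NumberTheory.EllipticCurves
open Literature.NumberTheory.EllipticCurves.HeathBrown1994
open Literature.NumberTheory.EllipticCurves.TianYuanZhang2017
open Literature.NumberTheory.EllipticCurves.MonskySelmerParity
open Literature.NumberTheory.EllipticCurves.Smith2016

set_option autoImplicit false

namespace Summit.BirchSwinnertonDyer.PrintCf2

variable {k : ℕ} (p : Fin k → ℕ)

/-! ## §0 Vector bookkeeping over `𝔽₂` -/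

/-- Vectors over `𝔽₂` are `2`-torsion. [folklore] -/
private theorem vadd_self {ι : Type*} (u : ι → ZMod 2) : u + u = 0 := by
  funext i; exact CharTwo.add_self_eq_zero (u i)

/-- In `𝔽₂`, from `u + w = 0` conclude `u = w`. [folklore] -/
private theorem eq_of_add_eq_zero' {ι : Type*} {u w : ι → ZMod 2} (h : u + w = 0) : u = w := by
  have := congrArg (· + w) h
  simp only [add_assoc, vadd_self, add_zero, zero_add] at this
  exact this

/-- `(u uᵀ) w = (u·w) u` (Mathlib's `vecMulVec_mulVec`, commutative form). [folklore] -/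
private theorem vecMulVec_mulVec_comm {ι : Type*} [Fintype ι] (u w : ι → ZMod 2) :
    vecMulVec u u *ᵥ w = (u ⬝ᵥ w) • u := by
  funext i
  simp only [mulVec, dotProduct, vecMulVec_apply, Pi.smul_apply, smul_eq_mul, Finset.sum_mul]
  exact Finset.sum_congr rfl fun j _ => by ring

/-- `c·𝟙 = Σ cᵢ`. [folklore] -/
private theorem dotProduct_one_eq_sum {ι : Type*} [Fintype ι] (u : ι → ZMod 2) : u ⬝ᵥ 1 = ∑ i, u i := by
  simp [dotProduct]

/-! ## §1 The kernel dictionary `M_odd → M₁` for `n ≡ 1 (mod 4)` -/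

section Dictionary

/-- `Σ tᵢ = 0` for `∏ pᵢ ≡ 1 (mod 4)`. [cite: HeathBrown1994SelmerCongruentII, Appendix (Monsky), typescript p. 39 L36–L37] -/
private theorem sum_t_eq_zero (hp : ∀ i, (p i).Prime) (hp2 : ∀ i, p i ≠ 2) (h4 : (∏ i, p i) % 4 = 1) :
    ∑ i, addLegendreSym (-1) (p i) = 0 := by
  rw [sum_addLegendreSym_neg_one_eq p hp hp2, if_pos h4]

/-- **Kernel dictionary, direction `M → M₁`.** For `n = p₁⋯p_k ≡ 1 (mod 4)` and a kernel vector `(x; y)` of Monsky's odd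
matrix, `v^S := (x + (t·y)𝟙; x + y)` lies in the kernel of Smith's `M₁ = (A + Aᵀ, Aᵀ; A, D₂)`. Proof:
`M₁ = P M₁ᴹ Q`, `Q v^S = (x; y) + (t·y)(𝟙; 𝟙)`, `M₁ᴹ = M + ccᵀ` with `c = (0;t) = M𝟙` and `c·𝟙 = Σt = 0`.
[cite: HeathBrown1994SelmerCongruentII, Appendix (Monsky), typescript p. 40 L1–L24] [cite: Smith2016CongruentDensity, §2 (the matrix M₁)] -/
theorem smithOne_mulVec_dict_eq_zero (hp : ∀ i, (p i).Prime) (hp2 : ∀ i, p i ≠ 2) (hinj : Function.Injective p)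
    (h4 : (∏ i, p i) % 4 = 1) {x y : Fin k → ZMod 2} (hv : monskyMatrixOdd p *ᵥ Sum.elim x y = 0) :
    fromBlocks (legendreMatrix p + (legendreMatrix p)ᵀ) (legendreMatrix p)ᵀ (legendreMatrix p)
        (legendreDiagonal p 2) *ᵥ
      Sum.elim (x + ((fun i => addLegendreSym (-1) (p i)) ⬝ᵥ y) • 1) (x + y) = 0 := by
  set t : Fin k → ZMod 2 := fun i => addLegendreSym (-1) (p i) with ht
  set ε : ZMod 2 := t ⬝ᵥ y with hε
  set c : Fin k ⊕ Fin k → ZMod 2 := Sum.elim 0 t with hc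
  -- `M₁ = P M₁ᴹ Q`, and `M₁ᴹ = M + c cᵀ`
  rw [← conj_M₁_eq p, ← monskyMatrixOdd_add_vecMulVec p hp hp2 hinj, ← mulVec_mulVec, ← mulVec_mulVec]
  -- `Q v^S = (x + ε𝟙; y + ε𝟙)`
  have hQ : fromBlocks (1 : Matrix (Fin k) (Fin k) (ZMod 2)) 0 1 1 *ᵥ Sum.elim (x + ε • 1) (x + y) =
      Sum.elim x y + ε • (1 : Fin k ⊕ Fin k → ZMod 2) := by
    rw [fromBlocks_mulVec]
    simp only [Sum.elim_comp_inl, Sum.elim_comp_inr, one_mulVec, zero_mulVec, add_zero]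
    have h2 : x + ε • 1 + (x + y) = y + ε • (1 : Fin k → ZMod 2) := by
      calc x + ε • 1 + (x + y) = (x + x) + (y + ε • 1) := by abel
        _ = y + ε • 1 := by rw [vadd_self, zero_add]
    rw [h2]
    ext (i | i) <;> simp
  -- `c · (v + ε𝟙) = t·y + ε Σt = ε`
  have hcw : c ⬝ᵥ (Sum.elim x y + ε • (1 : Fin k ⊕ Fin k → ZMod 2)) = ε := by
    rw [dotProduct_add, hc, sumElim_dotProduct_sumElim, zero_dotProduct, zero_add, dotProduct_smul,
      ← sum_elim_one_one, sumElim_dotProduct_sumElim, zero_dotProduct, zero_add, dotProduct_one_eq_sum,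
      sum_t_eq_zero p hp hp2 h4, smul_zero, add_zero]
  -- the middle factor vanishes: `(M + ccᵀ)(v + ε𝟙) = ε c + ε c = 0`
  have hinner : (monskyMatrixOdd p + vecMulVec c c) *ᵥ (Sum.elim x y + ε • (1 : Fin k ⊕ Fin k → ZMod 2)) = 0 := by
    rw [add_mulVec, mulVec_add, hv, zero_add, mulVec_smul, monskyMatrixOdd_mulVec_one p hp hp2,
      vecMulVec_mulVec_comm, hcw, ← hc]
    exact vadd_self _
  rw [hQ, hinner, mulVec_zero]

/-- Smith's `M₁` is symmetric. [cite: Smith2016CongruentDensity, §2 (M₁ = (A + Aᵀ, Aᵀ; A, D_z))] -/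
theorem smithOne_transpose :
    (fromBlocks (legendreMatrix p + (legendreMatrix p)ᵀ) (legendreMatrix p)ᵀ (legendreMatrix p)
        (legendreDiagonal p 2))ᵀ =
      fromBlocks (legendreMatrix p + (legendreMatrix p)ᵀ) (legendreMatrix p)ᵀ (legendreMatrix p)
        (legendreDiagonal p 2) := by
  rw [fromBlocks_transpose, transpose_transpose, transpose_add, transpose_transpose, add_comm (legendreMatrix p)ᵀ,
    legendreDiagonal, diagonal_transpose]

/-- The dictionary vector is nonzero when `(x; y)` is (for `n ≡ 1 (mod 4)`). [folklore] -/
theorem smithOne_dict_ne_zero (hp : ∀ i, (p i).Prime) (hp2 : ∀ i, p i ≠ 2) (h4 : (∏ i, p i) % 4 = 1)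
    {x y : Fin k → ZMod 2} (hne : Sum.elim x y ≠ 0) :
    Sum.elim (x + ((fun i => addLegendreSym (-1) (p i)) ⬝ᵥ y) • 1) (x + y) ≠ (0 : Fin k ⊕ Fin k → ZMod 2) := by
  set t : Fin k → ZMod 2 := fun i => addLegendreSym (-1) (p i) with ht
  intro h
  have hx : x + (t ⬝ᵥ y) • 1 = 0 := funext fun i => congr_fun h (Sum.inl i)
  have hxy : x + y = 0 := funext fun i => congr_fun h (Sum.inr i)
  have hyx : y = x := (eq_of_add_eq_zero' hxy).symm
  have hx' : x = (t ⬝ᵥ y) • 1 := eq_of_add_eq_zero' hx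
  -- `t·y = t·((t·y)𝟙) = (t·y) Σt = 0`
  have hε : t ⬝ᵥ y = 0 := by
    have h1 : t ⬝ᵥ y = (t ⬝ᵥ y) * (t ⬝ᵥ 1) := by
      conv_lhs => rw [hyx, hx', dotProduct_smul, smul_eq_mul]
    rw [h1, dotProduct_one_eq_sum, sum_t_eq_zero p hp hp2 h4, mul_zero]
  apply hne
  rw [hyx, hx', hε, zero_smul]
  exact Sum.elim_zero_zero

/-- **Kernel-pair transport `M → M₁`.** If Monsky's odd kernel has exactly two elements, one of them `(x; y) ≠ 0`, then
(for `n ≡ 1 (mod 4)`) Smith's `M₁` has kernel `{0, v^S}` with `v^S = (x + (t·y)𝟙; x + y)` — the ranks of `M` and `M₁`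
agree (tree `rank_monskyMatrixOdd_eq_rank_smithMatrixOne`), so both kernels have two elements.
[cite: HeathBrown1994SelmerCongruentII, Appendix (Monsky), typescript p. 40 L1–L24 (rank M = rank M₁ = rank M₂ for D ≡ 1 (mod 4))]
[cite: Smith2016CongruentDensity, §2 proof of Thm. 1.2 (rk Sel = 2 + crnk M₁)] -/
theorem smithOne_ker_pair (hp : ∀ i, (p i).Prime) (hodd : ∀ i, Odd (p i)) (hinj : Function.Injective p)
    (h4 : (∏ i, p i) % 4 = 1)
    (hker : Fintype.card {v : Fin k ⊕ Fin k → ZMod 2 // monskyMatrixOdd p *ᵥ v = 0} = 2)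
    {x y : Fin k → ZMod 2} (hv : monskyMatrixOdd p *ᵥ Sum.elim x y = 0) (hne : Sum.elim x y ≠ 0) :
    ∀ w, fromBlocks (legendreMatrix p + (legendreMatrix p)ᵀ) (legendreMatrix p)ᵀ (legendreMatrix p)
        (legendreDiagonal p 2) *ᵥ w = 0 →
      w = 0 ∨ w = Sum.elim (x + ((fun i => addLegendreSym (-1) (p i)) ⬝ᵥ y) • 1) (x + y) := by
  have hp2 : ∀ i, p i ≠ 2 := ne_two_of_odd p hodd
  set M₁ := fromBlocks (legendreMatrix p + (legendreMatrix p)ᵀ) (legendreMatrix p)ᵀ (legendreMatrix p)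
    (legendreDiagonal p 2) with hM₁
  -- both kernels have `2^{2k − rank}` elements and the ranks agree
  have hcardM : Fintype.card {v : Fin k ⊕ Fin k → ZMod 2 // monskyMatrixOdd p *ᵥ v = 0} =
      2 ^ (k + k - (monskyMatrixOdd p).rank) := by
    have h := natCard_ker_mulVecLin_eq (monskyMatrixOdd p)
    rwa [Nat.card_congr (Equiv.subtypeEquivRight (q := fun v => monskyMatrixOdd p *ᵥ v = 0)
      fun v => by rw [LinearMap.mem_ker, Matrix.mulVecLin_apply]), Nat.card_eq_fintype_card,
      Fintype.card_sum, Fintype.card_fin] at h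
  have hcard₁ : Fintype.card {v : Fin k ⊕ Fin k → ZMod 2 // M₁ *ᵥ v = 0} = 2 := by
    have h := natCard_ker_mulVecLin_eq M₁
    rw [Nat.card_congr (Equiv.subtypeEquivRight (q := fun v => M₁ *ᵥ v = 0)
      fun v => by rw [LinearMap.mem_ker, Matrix.mulVecLin_apply]), Nat.card_eq_fintype_card,
      Fintype.card_sum, Fintype.card_fin] at h
    rw [h, hM₁, ← rank_monskyMatrixOdd_eq_rank_smithMatrixOne p hp hodd hinj h4, ← hcardM, hker]
  obtain ⟨v', hv'0, -, hpair⟩ := exists_ker_pair_of_card_eq_two M₁ hcard₁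
  have hvS := smithOne_mulVec_dict_eq_zero p hp hp2 hinj h4 hv
  have hvSne := smithOne_dict_ne_zero p hp hp2 h4 hne
  have heq : Sum.elim (x + ((fun i => addLegendreSym (-1) (p i)) ⬝ᵥ y) • 1) (x + y) = v' :=
    ((hpair _ hvS).resolve_left hvSne)
  intro w hw
  rw [heq]
  exact hpair w hw

end Dictionary

/-! ## §2 `Σ₁(n)` as a linear functional of the Monsky kernel vector (`n ≡ 5 (mod 8)`, `s(n) = 1`) -/

section GenusOne

/-- `Σ (tᵢ + zᵢ) = 1` for `∏ pᵢ ≡ 5 (mod 8)` (an odd number of primes `≡ 5, 7 (mod 8)`).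
[cite: HeathBrown1994SelmerCongruentII, Appendix (Monsky), typescript p. 39 L36–L37] -/
private theorem sum_t_add_z_eq_one (hp : ∀ i, (p i).Prime) (hp2 : ∀ i, p i ≠ 2) (h8 : (∏ i, p i) % 8 = 5) :
    ∑ i, (addLegendreSym (-1) (p i) + addLegendreSym 2 (p i)) = 1 := by
  rw [sum_add_distrib, sum_addLegendreSym_neg_one_eq p hp hp2, sum_addLegendreSym_two_eq p hp hp2,
    if_pos (by omega), if_neg (by omega), zero_add]

/-- **`Σ₁(p₁⋯p_k) ≡ (t+z)·x + t·y (mod 2)`** for `n = p₁⋯p_k ≡ 5 (mod 8)` whose Monsky odd kernel is the pair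
`{0, (x; y)}` (`s(n) = 1`): Smith's row 5a (tree theorem `genusSum₁_eq_border_adjugate_five`: `Σ₁ ≡ uᵀ adj(M₁) u`,
`u = (t+z; 0)`), the adjugate of the symmetric `M₁` with kernel `{0, v^S}` is `v^S (v^S)ᵀ` (file 1), `v^S` from §1, and
`u·v^S = (t+z)·x + (t·y)(t+z)·𝟙 = (t+z)·x + t·y`. [cite: Smith2016CongruentDensity, Thm. 2.2 row 5a and §2.2]
[cite: TianYuanZhang2017, Thm. 1.2 (Σ₁)] [cite: HeathBrown1994SelmerCongruentII, Appendix (Monsky), typescript p. 39–40]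
[cite: HornJohnson2013, §0.8.2] -/
theorem genusSum₁_eq_dotProduct_of_kerPair_five (hp : ∀ i, (p i).Prime) (hodd : ∀ i, Odd (p i))
    (hinj : Function.Injective p) (h8 : (∏ i, p i) % 8 = 5)
    (hker : Fintype.card {v : Fin k ⊕ Fin k → ZMod 2 // monskyMatrixOdd p *ᵥ v = 0} = 2)
    {x y : Fin k → ZMod 2} (hv : monskyMatrixOdd p *ᵥ Sum.elim x y = 0) (hne : Sum.elim x y ≠ 0) :
    ((genusSum₁ (∏ i, p i) (fun d => genusClassNumber (GenusField d)) : ℕ) : ZMod 2) =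
      (fun i => addLegendreSym (-1) (p i) + addLegendreSym 2 (p i)) ⬝ᵥ x +
        (fun i => addLegendreSym (-1) (p i)) ⬝ᵥ y := by
  have hp2 : ∀ i, p i ≠ 2 := ne_two_of_odd p hodd
  have h4 : (∏ i, p i) % 4 = 1 := by omega
  rw [genusSum₁_eq_border_adjugate_five p hp hodd hinj h8,
    dotProduct_adjugate_mulVec_of_ker_pair _ (smithOne_transpose p) (smithOne_dict_ne_zero p hp hp2 h4 hne)
      (smithOne_mulVec_dict_eq_zero p hp hp2 hinj h4 hv) (smithOne_ker_pair p hp hodd hinj h4 hker hv hne),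
    sumElim_dotProduct_sumElim, zero_dotProduct, add_zero, dotProduct_add, dotProduct_smul, dotProduct_one_eq_sum,
    sum_t_add_z_eq_one p hp hp2 h8, smul_eq_mul, mul_one]

/-! ## §3 On the `ρ = 0` shapes of the flag-free TYZρ door: `Σ₁(n) ≡ z·x` -/

/-- **Shape `x + y = 0`** (a `ρ = 0` shape, tree `rhoIndex_eq_one_of_monskyKernel_odd`): for `n ≡ 5 (8)` with Monsky
kernel `{0, (x; x)}`, `Σ₁(n) ≡ z·x = Σ_{pᵢ ≡ ±3 (8)} xᵢ (mod 2)` (`(t+z)·x + t·x = z·x`).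
[cite: TianYuanZhang2017, §1 (ρ(n)) and Thm. 1.2] [cite: Smith2016CongruentDensity, Thm. 2.2 row 5a] -/
theorem genusSum₁_eq_of_kerShape_zero_five (hp : ∀ i, (p i).Prime) (hodd : ∀ i, Odd (p i))
    (hinj : Function.Injective p) (h8 : (∏ i, p i) % 8 = 5)
    (hker : Fintype.card {v : Fin k ⊕ Fin k → ZMod 2 // monskyMatrixOdd p *ᵥ v = 0} = 2)
    {x : Fin k → ZMod 2} (hv : monskyMatrixOdd p *ᵥ Sum.elim x x = 0) (hne : Sum.elim x x ≠ 0) :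
    ((genusSum₁ (∏ i, p i) (fun d => genusClassNumber (GenusField d)) : ℕ) : ZMod 2) =
      (fun i => addLegendreSym 2 (p i)) ⬝ᵥ x := by
  rw [genusSum₁_eq_dotProduct_of_kerPair_five p hp hodd hinj h8 hker hv hne,
    show (fun i => addLegendreSym (-1) (p i) + addLegendreSym 2 (p i)) =
      (fun i => addLegendreSym (-1) (p i)) + (fun i => addLegendreSym 2 (p i)) from rfl, add_dotProduct]
  calc (fun i => addLegendreSym (-1) (p i)) ⬝ᵥ x + (fun i => addLegendreSym 2 (p i)) ⬝ᵥ x +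
        (fun i => addLegendreSym (-1) (p i)) ⬝ᵥ x
      = (fun i => addLegendreSym 2 (p i)) ⬝ᵥ x +
          ((fun i => addLegendreSym (-1) (p i)) ⬝ᵥ x + (fun i => addLegendreSym (-1) (p i)) ⬝ᵥ x) := by abel
    _ = (fun i => addLegendreSym 2 (p i)) ⬝ᵥ x := by rw [CharTwo.add_self_eq_zero, add_zero]

/-- **Shape `x + y = 𝟙`** (the other `ρ = 0` shape): for `n ≡ 5 (8)` with Monsky kernel `{0, (x; x + 𝟙)}`,
`Σ₁(n) ≡ z·x (mod 2)` as well (`(t+z)·x + t·x + Σt = z·x`, `Σt = 0`). So on the whole flag-free TYZρ door at `n ≡ 5`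
the first genus sum is `Σ_{pᵢ ≡ ±3 (8)} xᵢ`. [cite: TianYuanZhang2017, §1 (ρ(n)) and Thm. 1.2] [cite: Smith2016CongruentDensity, Thm. 2.2 row 5a] -/
theorem genusSum₁_eq_of_kerShape_one_five (hp : ∀ i, (p i).Prime) (hodd : ∀ i, Odd (p i))
    (hinj : Function.Injective p) (h8 : (∏ i, p i) % 8 = 5)
    (hker : Fintype.card {v : Fin k ⊕ Fin k → ZMod 2 // monskyMatrixOdd p *ᵥ v = 0} = 2)
    {x : Fin k → ZMod 2} (hv : monskyMatrixOdd p *ᵥ Sum.elim x (x + 1) = 0) (hne : Sum.elim x (x + 1) ≠ 0) :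
    ((genusSum₁ (∏ i, p i) (fun d => genusClassNumber (GenusField d)) : ℕ) : ZMod 2) =
      (fun i => addLegendreSym 2 (p i)) ⬝ᵥ x := by
  have hp2 : ∀ i, p i ≠ 2 := ne_two_of_odd p hodd
  have h4 : (∏ i, p i) % 4 = 1 := by omega
  rw [genusSum₁_eq_dotProduct_of_kerPair_five p hp hodd hinj h8 hker hv hne,
    show (fun i => addLegendreSym (-1) (p i) + addLegendreSym 2 (p i)) =
      (fun i => addLegendreSym (-1) (p i)) + (fun i => addLegendreSym 2 (p i)) from rfl, add_dotProduct,
    dotProduct_add, dotProduct_one_eq_sum, sum_t_eq_zero p hp hp2 h4, add_zero]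
  calc (fun i => addLegendreSym (-1) (p i)) ⬝ᵥ x + (fun i => addLegendreSym 2 (p i)) ⬝ᵥ x +
        (fun i => addLegendreSym (-1) (p i)) ⬝ᵥ x
      = (fun i => addLegendreSym 2 (p i)) ⬝ᵥ x +
          ((fun i => addLegendreSym (-1) (p i)) ⬝ᵥ x + (fun i => addLegendreSym (-1) (p i)) ⬝ᵥ x) := by abel
    _ = (fun i => addLegendreSym 2 (p i)) ⬝ᵥ x := by rw [CharTwo.add_self_eq_zero, add_zero]

end GenusOne

end Summit.BirchSwinnertonDyer.PrintCf2

end
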